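import Mathlib
import HarnessLib
import Summits.HubbardSuperconductivity.HubbardSuperconductivity.Theorems.KLProgrammeKLRegimeEnginePairTransferMemberTowerValues
import Summits.HubbardSuperconductivity.HubbardSuperconductivity.Theorems.KLProgrammeKLRegimeSplitBornLocalisedRowFull

/-!
# Route `KLProgramme` — ENGINE (stmt-HubbardSuperconductivity-20437 `KLRegimeEngineV17F2`), row (c) binder #8: the PLAIN member's resolvent-tower package `htower`
# FROM hsucc-SHAPED ROWS with the Σ-class (6–2 / born self-energy row) in (C′) DATA FORM — **`klmt_htower_family_sigmaData`**
# (cell gate-hubbard-kl, seat hubbard-kl-k3c1-p1 g27, technique «composed-map remainder propagation»; sequel of `klmt_htower_family_values` (…MemberTowerValues, g26);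
# consumes k3c2-p2's cure-(C′) capstone `klok_localisedBorn_row_full_le` (…SplitBornLocalisedRowFull, O5c))

WHY.  `klmt_htower_family_values` (binder #8 level `hexLadMV`, ★ v19/v20) carries the 6–2 / born Σ-triple of the resolved source as ONE opaque VALUE row
`‖Σ_pΣ_σ(Ẇ_tβL²ĝ)(Φ_jβL²ĝ)·V6(p,σ;y,Qm−y,Qm−x,x)·Sg(p,σ)‖ ≤ RS x y` — a bound on a loop sum that only the expansion's owner (E1) can supply, and that is n-flat if charged
generically (located #22 «(c)-OUT-NEAR-SLICE-LEGS» (C), its in-class twin).  Cure (C′) (`HOME/hubbard-kl-k3c2-p2/g30/CURE-C-PRIME-DESIGN.md` §1–§2) LOCALISES the self-energy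
line: `V6·Sg = T σ·(Sg₀ + zω·iω_p + ze·e_p) + remainder`, and k3c2-p2's closer-side capstone O5c bounds the row by the five numbers `‖ΣT‖, ‖ΣT·Sg₀‖, ‖2zω+ze‖, ‖zω+ze‖, δ`
times rotation-, DOS-slope- and lattice-sized factors.  This file puts that capstone INTO the tower producer: **`klmt_htower_family_sigmaData`** = `klmt_htower_family_values` with the
`RS` VALUE row replaced, per `(t, x, y)`, by the LOCALISATION DATA `∃ (T : Fin 2 → ℂ) (Sg₀ zω ze : ℂ) (δ ≥ 0)`, the localisation row
`Ẇ_t(p) ≠ 0 → ‖V6(…)·Sg(p,σ) − T σ·(Sg₀ + zω·iω_p + ze·e_{K_{n+1}}(p))‖ ≤ δ` ((Σλ1)/(Σλ2) currency, E1) and ONE arithmetic domination row «O5c's closed-form majorant ≤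
`(Λₙ−Λₙ₊₁)(βL²)⁻³·RS x y`»; the value row is then a theorem (`klok_localisedBorn_row_full_le` + division by the positive prefactor).  The radial profile hypotheses of O5c are
DISCHARGED here (`klmt_sliceProfile`: inner radius `Λ(t)/2`, sup `8/Λₙ₊₁`, Lipschitz `(2B₂+72)/Λₙ₊₁³`); the C4a chart / frame data (`B`, `Af`, `r`) and the Matsubara box stay
hypotheses of this generic producer and are discharged under row (c)'s doors by the reader (`EngineV8.rowC_frameWindow` lineage).  Every other row (a priori ×2, (F)(i) model
row + cap, smallness, `RH RP RQ RL`, consumer rows) and the fourteen-conjunct conclusion are those of `klmt_htower_family_values` VERBATIM.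
Plumbing + elementary real analysis over landed doors; the localisation data and all rows are producer HYPOTHESES (E1 / class #1 / (c) closer / k3c2-p2); nothing here asserts (c),
any open row of 20437, K3, U₀, the window or superconductivity.  0 kit · 0 lit.  [cite: BenfattoGiulianiMastropietro2006, §2.9]
-/

noncomputable section

namespace Summit.HubbardSuperconductivity.HubbardSuperconductivity.Theorems.KLRegimeSplit

set_option linter.dupNamespace false -- summit = problem name (single-conjunct summit), D-0017

open Finset Matrix Set Literature.MathematicalPhysics.QuantumLattice Literature.Probability.LatticeModels GrassmannAlgebra
open Summit.HubbardSuperconductivity.HubbardSuperconductivity.Theorems.KLProgrammeLegKernels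
open Summit.HubbardSuperconductivity.HubbardSuperconductivity.Theorems.TwoPointAssembly
open Summit.HubbardSuperconductivity.HubbardSuperconductivity.Theorems.DispersionFlow
open Summit.HubbardSuperconductivity.HubbardSuperconductivity.Theorems.KLRegimeWick
open Summit.HubbardSuperconductivity.HubbardSuperconductivity.Theorems.EngineV8
open Literature.MathematicalPhysics.QuantumLattice.BandSectorCounting
open Summit.HubbardSuperconductivity.HubbardSuperconductivity.Theorems.PerturbedFermiCurve
open Real

variable (L M : ℕ) [NeZero L] [NeZero M]

/-- **The slice profile `klWd Λ · klPhi Λₙ₊₁ Λ` along the slice `Λ ∈ [Λₙ₊₁, Λₙ]`** meets O5c's four profile rows with EXPLICIT constants: inner radius `Λ/2`,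
sup `8/Λₙ₊₁`, Lipschitz `(2B₂ + 72)/Λₙ₊₁³` (`B₂ = 448e²/3`), and vanishing for `s ≤ (Λ/2)²` and `Λ² ≤ s` (from `abs_klWd_le`, `klWd_lipschitz`, `klWd_eq_zero_of_le/ge`,
`abs_klPhi_le_one`, `klPhi_lipschitz`). -/
theorem klmt_sliceProfile {n : ℕ} {Λ : ℝ} (hlo : klScale klE0 (n + 1) ≤ Λ) (hhi : Λ ≤ klScale klE0 n) :
    0 < Λ / 2 ∧
    (∀ s, |klWd Λ s * klPhi (klScale klE0 (n + 1)) Λ s| ≤ 8 / klScale klE0 (n + 1)) ∧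
    (∀ s s', |klWd Λ s * klPhi (klScale klE0 (n + 1)) Λ s - klWd Λ s' * klPhi (klScale klE0 (n + 1)) Λ s'| ≤
      (2 * (448 / 3 * Real.exp 2) + 72) / klScale klE0 (n + 1) ^ 3 * |s - s'|) ∧
    (∀ s, s ≤ (Λ / 2) ^ 2 → klWd Λ s * klPhi (klScale klE0 (n + 1)) Λ s = 0) ∧
    (∀ s, Λ ^ 2 ≤ s → klWd Λ s * klPhi (klScale klE0 (n + 1)) Λ s = 0) := by
  have hΛ1 : 0 < klScale klE0 (n + 1) := klth_klScale_pos (n + 1)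
  have hΛ : 0 < Λ := hΛ1.trans_le hlo
  have _hhi := hhi
  have hB : 0 ≤ 2 * (448 / 3 * Real.exp 2) + 8 := by positivity
  refine ⟨by positivity, fun s => ?_, fun s s' => ?_, fun s hs => ?_, fun s hs => ?_⟩
  · rw [abs_mul]
    calc |klWd Λ s| * |klPhi (klScale klE0 (n + 1)) Λ s| ≤ 8 / Λ * 1 :=
          mul_le_mul (abs_klWd_le hΛ s) (abs_klPhi_le_one _ _ s) (abs_nonneg _) (by positivity)
      _ ≤ 8 / klScale klE0 (n + 1) := by rw [mul_one]; exact div_le_div_of_nonneg_left (by norm_num) hΛ1 hlo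
  · have h1 := abs_klWd_le hΛ s
    have h2 := klWd_lipschitz hΛ s s'
    have h3 := abs_klPhi_le_one (klScale klE0 (n + 1)) Λ s'
    have h4 := klPhi_lipschitz hΛ1 hlo s s'
    have hss : 0 ≤ |s - s'| := abs_nonneg _
    have e : klWd Λ s * klPhi (klScale klE0 (n + 1)) Λ s - klWd Λ s' * klPhi (klScale klE0 (n + 1)) Λ s' =
        klWd Λ s * (klPhi (klScale klE0 (n + 1)) Λ s - klPhi (klScale klE0 (n + 1)) Λ s') + (klWd Λ s - klWd Λ s') * klPhi (klScale klE0 (n + 1)) Λ s' := by ring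
    rw [e]
    have hΛ3 : Λ ^ 3 ≥ klScale klE0 (n + 1) ^ 3 := pow_le_pow_left₀ hΛ1.le hlo 3
    have hinv1 : 8 / Λ ≤ 8 / klScale klE0 (n + 1) := div_le_div_of_nonneg_left (by norm_num) hΛ1 hlo
    have hinv3 : (2 * (448 / 3 * Real.exp 2) + 8) / Λ ^ 3 ≤ (2 * (448 / 3 * Real.exp 2) + 8) / klScale klE0 (n + 1) ^ 3 :=
      div_le_div_of_nonneg_left hB (by positivity) hΛ3
    calc |klWd Λ s * (klPhi (klScale klE0 (n + 1)) Λ s - klPhi (klScale klE0 (n + 1)) Λ s') + (klWd Λ s - klWd Λ s') * klPhi (klScale klE0 (n + 1)) Λ s'|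
        ≤ |klWd Λ s * (klPhi (klScale klE0 (n + 1)) Λ s - klPhi (klScale klE0 (n + 1)) Λ s')| + |(klWd Λ s - klWd Λ s') * klPhi (klScale klE0 (n + 1)) Λ s'| :=
          abs_add_le _ _
      _ = |klWd Λ s| * |klPhi (klScale klE0 (n + 1)) Λ s - klPhi (klScale klE0 (n + 1)) Λ s'| + |klWd Λ s - klWd Λ s'| * |klPhi (klScale klE0 (n + 1)) Λ s'| := by
          rw [abs_mul, abs_mul]
      _ ≤ 8 / klScale klE0 (n + 1) * (8 / klScale klE0 (n + 1) ^ 2 * |s - s'|) + (2 * (448 / 3 * Real.exp 2) + 8) / klScale klE0 (n + 1) ^ 3 * |s - s'| * 1 := by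
          gcongr
          · exact h1.trans hinv1
          · exact h2.trans (mul_le_mul_of_nonneg_right hinv3 hss)
      _ = (2 * (448 / 3 * Real.exp 2) + 72) / klScale klE0 (n + 1) ^ 3 * |s - s'| := by
          field_simp
          ring
  · rw [klWd_eq_zero_of_le hΛ (by rw [div_pow] at hs; linarith), zero_mul]
  · rw [klWd_eq_zero_of_ge hΛ hs, zero_mul]

set_option maxHeartbeats 3200000 in -- long pinning equations (h5g″'s hsucc pins) + fourteen-conjunct package; plumbing only
/-- **`klmt_htower_family_sigmaData`** — the `htower` package (keying `(n, n+1)`, generic bar `Tb` / slot `Bar`) of the PLAIN member from hsucc-shaped rows with the loop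
classes `RH RP RQ RL` as localised VALUE rows and the Σ-class in (C′) DATA form (module docstring). [cite: BenfattoGiulianiMastropietro2006, §2.9] -/
theorem klmt_htower_family_sigmaData {β U μ : ℝ} {n N : ℕ} {m : ℝ} (hm : 0 ≤ m) (hm7 : 3 / 2 * m * 738288 ≤ 1 / 3) {Rn : RenConsts} {G : GeoConsts}
    (hK : FrameOK Rn U N μ (klFlowFrameU L M β U μ (n + 1))) (hβ : klBetaMin ≤ β) (hβL : β ≤ L) (hG : (2 : ℝ) ^ 19 ≤ G.bhi)
    (hZ : ∀ Λ ∈ Icc (klScale klE0 (n + 1)) (klScale klE0 n), hubbardEffPartitionFnCT L M β U μ 0 (klFlowFrameU L M β U μ (n + 1)) Λ ≠ 0)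
    (A A' : ℕ → TorusSite 2 L → ℝ → Matrix (TorusSite 2 L) (TorusSite 2 L) ℂ) (b b' : ℕ → TorusSite 2 L → ℝ → TorusSite 2 L → ℂ)
    (ρ : ℕ → TorusSite 2 L → TorusSite 2 L → ℝ) (V : ℕ → ℝ → (Fin 4 → HubbardFieldIdx L M) → ℂ) (V6 : ℕ → ℝ → (Fin 6 → HubbardFieldIdx L M) → ℂ)
    (Sg : ℕ → ℝ → FreqMomentum L M → Fin 2 → ℂ) (Hd : ℕ → ℝ → (Fin 4 → HubbardFieldIdx L M) → ℂ) (Φ : ℕ → ℝ → FreqMomentum L M → ℝ) (Wd : ℝ → FreqMomentum L M → ℝ)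
    (Br : ℕ → TorusSite 2 L → ℝ → TorusSite 2 L × MatsubaraIdx M → ℂ)
    (hAdef : A = fun j Qm t => Matrix.of fun k k' : TorusSite 2 L => if k ∈ klBall L μ 0 ∧ k' ∈ klBall L μ 0 then vertexFn L M β (gaussConv ℂ (softCovOf L M β μ (klFlowFrameU L M β U μ (n + 1)) (softSymbolCompl L M β μ (klFlowFrameU L M β U μ (n + 1)) (n + 1) j) + hubbardCovAboveCT L M β μ 0 (klFlowFrameU L M β U μ (n + 1)) (klScale klE0 (n + 1)) - hubbardCovAboveCT L M β μ 0 (klFlowFrameU L M β U μ (n + 1)) (klScale klE0 n + t * (klScale klE0 (n + 1) - klScale klE0 n))) (hubbardEffectiveActionCT L M β U μ 0 (klFlowFrameU L M β U μ (n + 1)) (klScale klE0 n + t * (klScale klE0 (n + 1) - klScale klE0 n)))) 4 ![(((omega0 M, k'), 0), 0), ((((omega0 M).rev, Qm - k'), 1), 0), ((((omega0 M).rev, Qm - k), 1), 1), (((omega0 M, k), 0), 1)] else 0)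
    (hA'def : A' = fun j Qm t => Matrix.of fun k k' : TorusSite 2 L => if k ∈ klBall L μ 0 ∧ k' ∈ klBall L μ 0 then (klScale klE0 (n + 1) - klScale klE0 n) • -((2 : ℂ)⁻¹ * vertexFn L M β (gaussConv ℂ (softCovOf L M β μ (klFlowFrameU L M β U μ (n + 1)) (softSymbolCompl L M β μ (klFlowFrameU L M β U μ (n + 1)) (n + 1) j) + hubbardCovAboveCT L M β μ 0 (klFlowFrameU L M β U μ (n + 1)) (klScale klE0 (n + 1)) - hubbardCovAboveCT L M β μ 0 (klFlowFrameU L M β U μ (n + 1)) (klScale klE0 n + t * (klScale klE0 (n + 1) - klScale klE0 n))) (grassmannDerivPairing ℂ (Matrix.of fun X Y : HubbardFieldIdx L M => deriv (fun Λ'' : ℝ => hubbardCovAboveCT L M β μ 0 (klFlowFrameU L M β U μ (n + 1)) Λ'' X Y) (klScale klE0 n + t * (klScale klE0 (n + 1) - klScale klE0 n))) (hubbardEffectiveActionCT L M β U μ 0 (klFlowFrameU L M β U μ (n + 1)) (klScale klE0 n + t * (klScale klE0 (n + 1) - klScale klE0 n))) (hubbardEffectiveActionCT L M β U μ 0 (klFlowFrameU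 L M β U μ (n + 1)) (klScale klE0 n + t * (klScale klE0 (n + 1) - klScale klE0 n))))) 4 ![(((omega0 M, k'), 0), 0), ((((omega0 M).rev, Qm - k'), 1), 0), ((((omega0 M).rev, Qm - k), 1), 1), (((omega0 M, k), 0), 1)]) else 0)
    (hbdef : b = fun j Qm t p => -((klBubbleMass L M β μ (klFlowFrameU L M β U μ (n + 1)) (fun k => (softSymbolCompl L M β μ (klFlowFrameU L M β U μ (n + 1)) (n + 1) j) k + (hubbardCutoffWeightCT L M β μ (klFlowFrameU L M β U μ (n + 1)) (klScale klE0 (n + 1)) k - hubbardCutoffWeightCT L M β μ (klFlowFrameU L M β U μ (n + 1)) (klScale klE0 n + t * (klScale klE0 (n + 1) - klScale klE0 n)) k)) (fun k => (softSymbolCompl L M β μ (klFlowFrameU L M β U μ (n + 1)) (n + 1) j) k + (hubbardCutoffWeightCT L M β μ (klFlowFrameU L M β U μ (n + 1)) (klScale klE0 (n + 1)) k - hubbardCutoffWeightCT L M β μ (klFlowFrameU L M β U μ (n + 1)) (klScale klE0 n + t * (klScale klE0 (n + 1) - klScale klE0 n)) k)) Qm p : ℝ) : ℂ))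
    (hb'def : b' = fun j Qm t p => (((klScale klE0 (n + 1) - klScale klE0 n) * (klBubbleMass L M β μ (klFlowFrameU L M β U μ (n + 1)) (fun k => deriv (fun Λ' => hubbardCutoffWeightCT L M β μ (klFlowFrameU L M β U μ (n + 1)) Λ' k) (klScale klE0 n + t * (klScale klE0 (n + 1) - klScale klE0 n))) (fun k => (softSymbolCompl L M β μ (klFlowFrameU L M β U μ (n + 1)) (n + 1) j) k + (hubbardCutoffWeightCT L M β μ (klFlowFrameU L M β U μ (n + 1)) (klScale klE0 (n + 1)) k - hubbardCutoffWeightCT L M β μ (klFlowFrameU L M β U μ (n + 1)) (klScale klE0 n + t * (klScale klE0 (n + 1) - klScale klE0 n)) k)) Qm p + klBubbleMass L M β μ (klFlowFrameU L M β U μ (n + 1)) (fun k => (softSymbolCompl L M β μ (klFlowFrameU L M β U μ (n + 1)) (n + 1) j) k + (hubbardCutoffWeightCT L M β μ (klFlowFrameU L M β U μ (n + 1)) (klScale klE0 (n + 1)) k - hubbardCutoffWeightCT L M β μ (klFlowFrameU L M β U μ (n + 1)) (klScale klE0 n + t * (klScale klE0 (n + 1) - klScale klE0 n)) k)) (fun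 k => deriv (fun Λ' => hubbardCutoffWeightCT L M β μ (klFlowFrameU L M β U μ (n + 1)) Λ' k) (klScale klE0 n + t * (klScale klE0 (n + 1) - klScale klE0 n))) Qm p) : ℝ) : ℂ))
    (hρdef : ρ = fun j Qm c => klRungProfile L M β μ (klFlowFrameU L M β U μ (n + 1)) n (softSymbolCompl L M β μ (klFlowFrameU L M β U μ (n + 1)) (n + 1) j) Qm c)
    (hV : V = fun j t X => vertexFn L M β (gaussConv ℂ (softCovOf L M β μ (klFlowFrameU L M β U μ (n + 1)) (softSymbolCompl L M β μ (klFlowFrameU L M β U μ (n + 1)) (n + 1) j) + hubbardCovAboveCT L M β μ 0 (klFlowFrameU L M β U μ (n + 1)) (klScale klE0 (n + 1)) - hubbardCovAboveCT L M β μ 0 (klFlowFrameU L M β U μ (n + 1)) (klScale klE0 n + t * (klScale klE0 (n + 1) - klScale klE0 n))) (hubbardEffectiveActionCT L M β U μ 0 (klFlowFrameU L M β U μ (n + 1)) (klScale klE0 n + t * (klScale klE0 (n + 1) - klScale klE0 n)))) 4 X)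
    (hV6 : V6 = fun j t X => vertexFn L M β (gaussConv ℂ (softCovOf L M β μ (klFlowFrameU L M β U μ (n + 1)) (softSymbolCompl L M β μ (klFlowFrameU L M β U μ (n + 1)) (n + 1) j) + hubbardCovAboveCT L M β μ 0 (klFlowFrameU L M β U μ (n + 1)) (klScale klE0 (n + 1)) - hubbardCovAboveCT L M β μ 0 (klFlowFrameU L M β U μ (n + 1)) (klScale klE0 n + t * (klScale klE0 (n + 1) - klScale klE0 n))) (hubbardEffectiveActionCT L M β U μ 0 (klFlowFrameU L M β U μ (n + 1)) (klScale klE0 n + t * (klScale klE0 (n + 1) - klScale klE0 n)))) 6 X)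
    (hSg : Sg = fun j t p σ => selfEnergy L M β (gaussConv ℂ (softCovOf L M β μ (klFlowFrameU L M β U μ (n + 1)) (softSymbolCompl L M β μ (klFlowFrameU L M β U μ (n + 1)) (n + 1) j) + hubbardCovAboveCT L M β μ 0 (klFlowFrameU L M β U μ (n + 1)) (klScale klE0 (n + 1)) - hubbardCovAboveCT L M β μ 0 (klFlowFrameU L M β U μ (n + 1)) (klScale klE0 n + t * (klScale klE0 (n + 1) - klScale klE0 n))) (hubbardEffectiveActionCT L M β U μ 0 (klFlowFrameU L M β U μ (n + 1)) (klScale klE0 n + t * (klScale klE0 (n + 1) - klScale klE0 n)))) p σ)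
    (hHd : Hd = fun j t X => vertexFn L M β (dblFold ℂ (grassmannLaplacian ℂ (crossCov ℂ (Matrix.of fun X Y : HubbardFieldIdx L M => deriv (fun Λ' : ℝ => hubbardCovAboveCT L M β μ 0 (klFlowFrameU L M β U μ (n + 1)) Λ' X Y) (klScale klE0 n + t * (klScale klE0 (n + 1) - klScale klE0 n)))) ((gaussConv ℂ (crossCov ℂ (softCovOf L M β μ (klFlowFrameU L M β U μ (n + 1)) (softSymbolCompl L M β μ (klFlowFrameU L M β U μ (n + 1)) (n + 1) j) + hubbardCovAboveCT L M β μ 0 (klFlowFrameU L M β U μ (n + 1)) (klScale klE0 (n + 1)) - hubbardCovAboveCT L M β μ 0 (klFlowFrameU L M β U μ (n + 1)) (klScale klE0 n + t * (klScale klE0 (n + 1) - klScale klE0 n)))) - grassmannLaplacian ℂ (crossCov ℂ (softCovOf L M β μ (klFlowFrameU L M β U μ (n + 1)) (softSymbolCompl L M β μ (klFlowFrameU L M β U μ (n + 1)) (n + 1) j) + hubbardCovAboveCT L M β μ 0 (klFlowFrameU L M β U μ (n + 1)) (klScale klE0 (n + 1)) - hubbardCovAboveCT L M β μ 0 (klFlowFrameU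 L M β U μ (n + 1)) (klScale klE0 n + t * (klScale klE0 (n + 1) - klScale klE0 n))))) (dblCopy ℂ 0 (gaussConv ℂ (softCovOf L M β μ (klFlowFrameU L M β U μ (n + 1)) (softSymbolCompl L M β μ (klFlowFrameU L M β U μ (n + 1)) (n + 1) j) + hubbardCovAboveCT L M β μ 0 (klFlowFrameU L M β U μ (n + 1)) (klScale klE0 (n + 1)) - hubbardCovAboveCT L M β μ 0 (klFlowFrameU L M β U μ (n + 1)) (klScale klE0 n + t * (klScale klE0 (n + 1) - klScale klE0 n))) (hubbardEffectiveActionCT L M β U μ 0 (klFlowFrameU L M β U μ (n + 1)) (klScale klE0 n + t * (klScale klE0 (n + 1) - klScale klE0 n)))) * dblCopy ℂ 1 (gaussConv ℂ (softCovOf L M β μ (klFlowFrameU L M β U μ (n + 1)) (softSymbolCompl L M β μ (klFlowFrameU L M β U μ (n + 1)) (n + 1) j) + hubbardCovAboveCT L M β μ 0 (klFlowFrameU L M β U μ (n + 1)) (klScale klE0 (n + 1)) - hubbardCovAboveCT L M β μ 0 (klFlowFrameU L M β U μ (n + 1)) (klScale klE0 n + t * (klScale klE0 (n + 1) - klScale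 klE0 n))) (hubbardEffectiveActionCT L M β U μ 0 (klFlowFrameU L M β U μ (n + 1)) (klScale klE0 n + t * (klScale klE0 (n + 1) - klScale klE0 n)))))))) 4 X)
    (hΦ : Φ = fun j t k => (softSymbolCompl L M β μ (klFlowFrameU L M β U μ (n + 1)) (n + 1) j) k + (hubbardCutoffWeightCT L M β μ (klFlowFrameU L M β U μ (n + 1)) (klScale klE0 (n + 1)) k - hubbardCutoffWeightCT L M β μ (klFlowFrameU L M β U μ (n + 1)) (klScale klE0 n + t * (klScale klE0 (n + 1) - klScale klE0 n)) k))
    (hWd : Wd = fun t k => deriv (fun Λ' : ℝ => hubbardCutoffWeightCT L M β μ (klFlowFrameU L M β U μ (n + 1)) Λ' k) (klScale klE0 n + t * (klScale klE0 (n + 1) - klScale klE0 n)))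
    (hBr : Br = fun j Qm t z => -(((((β * (L : ℝ) ^ 2 : ℝ) : ℂ)))⁻¹ * propCT L M β μ (klFlowFrameU L M β U μ (n + 1)) (z.2, z.1) * propCT L M β μ (klFlowFrameU L M β U μ (n + 1)) (z.2.rev, Qm - z.1)) * ((((klScale klE0 (n + 1) - klScale klE0 n) * (-Wd t (z.2, z.1) * Φ j t (z.2.rev, Qm - z.1) - Φ j t (z.2, z.1) * Wd t (z.2.rev, Qm - z.1))) : ℝ) : ℂ))
    -- C4a chart / frame data of `K_(n+1)` and the Matsubara box along the slice [GEO; discharged under row (c)'s doors by the reader]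
    {a₀ b₀ : ℝ} (B : BandBounds a₀ b₀) {Af : ℝ} (hAf : ∀ p : Momentum, ∀ j ≤ 2, ‖iteratedFDeriv ℝ j (frameShift (klFlowFrameU L M β U μ (n + 1))) p‖ ≤ Af) (hADt : 2 * Af < B.Dtmin)
    {r : ℝ} (hlo : a₀ < μ - r - Af) (hhi : μ + r + Af < b₀)
    (hΛr : ∀ t ∈ Icc (0 : ℝ) 1, (klScale klE0 n + t * (klScale klE0 (n + 1) - klScale klE0 n)) + (4 + 2 * Af) * (2 * π / L) < r)
    (hMt : ∀ t ∈ Icc (0 : ℝ) 1, β * (klScale klE0 n + t * (klScale klE0 (n + 1) - klScale klE0 n)) / (2 * Real.pi) + 1 ≤ M)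
    (Tb Bar : TorusSite 2 L → TorusSite 2 L → TorusSite 2 L → ℝ)
    (hrows : ∀ Qm : TorusSite 2 L, IsPairClassAt L Qm (n + 1) →
      ∃ (r' e₁ : ℝ) (η E₁ RH RP RQ RS RL : TorusSite 2 L → TorusSite 2 L → ℝ), 0 ≤ r' ∧ 0 ≤ e₁ ∧
        -- a priori along the slice; history a priori [class #1]
        (∀ t ∈ Icc (0 : ℝ) 1, ∀ x y, ‖A (n + 1) Qm t x y‖ ≤ m) ∧
        (∀ x y, ‖klMemberArrayF L M β U μ n (softSymbolCompl L M β μ (klFlowFrameU L M β U μ n) n (n + 1)) Qm x y‖ ≤ m) ∧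
        -- (F)(i): majorant of the FRAME SHIFT `K_n → K_(n+1)` of the history member (model objects) + its scalar cap [k3c2-p2]
        (∀ x y, ‖((Matrix.of fun k k' : TorusSite 2 L => if k ∈ klBall L μ 0 ∧ k' ∈ klBall L μ 0 then klCovSmearedPairAmplitude L M β U μ (klFlowFrameU L M β U μ (n + 1)) n (softCovOf L M β μ (klFlowFrameU L M β U μ (n + 1)) (softSymbolCompl L M β μ (klFlowFrameU L M β U μ (n + 1)) n (n + 1))) Qm k k' else 0) - klMemberArrayF L M β U μ n (softSymbolCompl L M β μ (klFlowFrameU L M β U μ n) n (n + 1)) Qm) x y‖ ≤ η x y) ∧ (∀ x y, η x y ≤ r') ∧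
        -- smallness of the NAMED tower weight
        (3 / 2 * m + r') * ∑ p, |klSliceWeightSmeared L M β μ (klFlowFrameU L M β U μ (n + 1)) (n + 1) (fun _ => (0 : ℝ)) Qm p| ≤ 1 / 3 ∧
        -- the FIVE loop classes of the resolved source AS LOCALISED VALUE ROWS (`klmd_defect_le_rows_family`'s own hypotheses at `j = n+1`, kernels INSIDE the loop sums,
        -- norm outside; NO kernel sup, NO weight mass): «≥ 2 cross lines» `RH`, particle–hole direct `RP`, particle–hole exchange `RQ`, the 6–2 / born Σ-triple `RS`, localisation `RL`
        (∀ t ∈ Icc (0 : ℝ) 1, ∀ x y : TorusSite 2 L, ‖Hd (n + 1) t ![(((omega0 M, y), 0), 0), ((((omega0 M).rev, Qm - y), 1), 0), ((((omega0 M).rev, Qm - x), 1), 1), (((omega0 M, x), 0), 1)]‖ ≤ RH x y) ∧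
        (∀ t ∈ Icc (0 : ℝ) 1, ∀ x y : TorusSite 2 L, ‖(∑ p : FreqMomentum L M, ∑ σ : Fin 2, ∑ p' : FreqMomentum L M, if matsubaraInt M p'.1 + matsubaraInt M (omega0 M) = matsubaraInt M p.1 + matsubaraInt M (omega0 M) ∧ p'.2 = p.2 + x - y then ((((((Φ (n + 1) t p) : ℝ) : ℂ) * (((β * (L : ℝ) ^ 2 : ℝ) : ℂ) * propCT L M β μ (klFlowFrameU L M β U μ (n + 1)) p)) * ((((Wd t p') : ℝ) : ℂ) * (((β * (L : ℝ) ^ 2 : ℝ) : ℂ) * propCT L M β μ (klFlowFrameU L M β U μ (n + 1)) p'))) + (((((Wd t p) : ℝ) : ℂ) * (((β * (L : ℝ) ^ 2 : ℝ) : ℂ) * propCT L M β μ (klFlowFrameU L M β U μ (n + 1)) p)) * ((((Φ (n + 1) t p') : ℝ) : ℂ) * (((β * (L : ℝ) ^ 2 : ℝ) : ℂ) * propCT L M β μ (klFlowFrameU L M β U μ (n + 1)) p')))) * (V (n + 1) t ![((p, σ), 1), ((p', σ), 0), (((omega0 M, y), 0), 0), (((omega0 M, x), 0), 1)] * V (n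 + 1) t ![((p, σ), 0), ((p', σ), 1), ((((omega0 M).rev, Qm - y), 1), 0), ((((omega0 M).rev, Qm - x), 1), 1)]) else 0)‖ ≤ RP x y) ∧
        (∀ t ∈ Icc (0 : ℝ) 1, ∀ x y : TorusSite 2 L, ‖(∑ p : FreqMomentum L M, ∑ p' : FreqMomentum L M, if matsubaraInt M p'.1 + matsubaraInt M (omega0 M) + matsubaraInt M (omega0 M) + 1 = matsubaraInt M p.1 ∧ p'.2 = p.2 + Qm - x - y then ((((((Φ (n + 1) t p) : ℝ) : ℂ) * (((β * (L : ℝ) ^ 2 : ℝ) : ℂ) * propCT L M β μ (klFlowFrameU L M β U μ (n + 1)) p)) * ((((Wd t p') : ℝ) : ℂ) * (((β * (L : ℝ) ^ 2 : ℝ) : ℂ) * propCT L M β μ (klFlowFrameU L M β U μ (n + 1)) p'))) + (((((Wd t p) : ℝ) : ℂ) * (((β * (L : ℝ) ^ 2 : ℝ) : ℂ) * propCT L M β μ (klFlowFrameU L M β U μ (n + 1)) p)) * ((((Φ (n + 1) t p') : ℝ) : ℂ) * (((β * (L : ℝ) ^ 2 : ℝ) : ℂ) * propCT L M β μ (klFlowFrameU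 L M β U μ (n + 1)) p')))) * (V (n + 1) t ![((p, 0), 1), ((p', 1), 0), (((omega0 M, y), 0), 0), ((((omega0 M).rev, Qm - x), 1), 1)] * V (n + 1) t ![((p, 0), 0), ((p', 1), 1), ((((omega0 M).rev, Qm - y), 1), 0), (((omega0 M, x), 0), 1)]) else 0)‖ ≤ RQ x y) ∧
        -- the 6–2 / born Σ-class IN (C′) DATA FORM [E1: (Σλ1)/(Σλ2)]: per `(t, x, y)` the self-energy line's LOCALISATION DATA `(T, Sg₀, zω, ze, δ)` on the hard shell and
        -- ONE arithmetic domination row (O5c's closed-form majorant, profile constants discharged, `≤` the Σ-slot `(Λd)(βL²)⁻³·RS`); the VALUE row `‖Σ_pΣ_σ(Ẇĝ)(Φĝ)·V6·Sg‖ ≤ RS`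
        -- of `klmt_htower_family_values` is DERIVED inside (`klok_localisedBorn_row_full_le`)
        (∀ t ∈ Icc (0 : ℝ) 1, ∀ x y : TorusSite 2 L, ∃ (T : Fin 2 → ℂ) (Sg₀ zω ze : ℂ) (δ : ℝ), 0 ≤ δ ∧
          (∀ p : FreqMomentum L M, ∀ σ : Fin 2, Wd t p ≠ 0 →
            ‖V6 (n + 1) t ![((p, σ), 0), ((p, σ), 1), (((omega0 M, y), 0), 0), ((((omega0 M).rev, Qm - y), 1), 0), ((((omega0 M).rev, Qm - x), 1), 1), (((omega0 M, x), 0), 1)] * Sg (n + 1) t p σ -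
                T σ * (Sg₀ + zω * (Complex.I * (matsubaraFreq β M p.1 : ℂ)) + ze * (nambuXiCT L μ (klFlowFrameU L M β U μ (n + 1)) p.2 : ℂ))‖ ≤ δ) ∧
          (klScale klE0 n - klScale klE0 (n + 1)) / (β * (L : ℝ) ^ 2) * ‖∑ σ : Fin 2, T σ‖ *
            ((‖2 * zω + ze‖ * (((klScale klE0 n + t * (klScale klE0 (n + 1) - klScale klE0 n)) * β / π + 1) * ((8 / klScale klE0 (n + 1)) / ((klScale klE0 n + t * (klScale klE0 (n + 1) - klScale klE0 n)) / 2) ^ 2) +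
                2 * (klScale klE0 n + t * (klScale klE0 (n + 1) - klScale klE0 n)) *
                  (((klScale klE0 n + t * (klScale klE0 (n + 1) - klScale klE0 n)) * β / π + 1) * (((2 * (448 / 3 * Real.exp 2) + 72) / klScale klE0 (n + 1) ^ 3) / ((klScale klE0 n + t * (klScale klE0 (n + 1) - klScale klE0 n)) / 2) ^ 2 + (8 / klScale klE0 (n + 1)) / ((klScale klE0 n + t * (klScale klE0 (n + 1) - klScale klE0 n)) / 2) ^ 4)) *
                  (2 * (2 * (klScale klE0 n + t * (klScale klE0 (n + 1) - klScale klE0 n))))) +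
              2 * ‖zω + ze‖ * (3 * (2 * (klScale klE0 n + t * (klScale klE0 (n + 1) - klScale klE0 n))) ^ 2 *
                  (((klScale klE0 n + t * (klScale klE0 (n + 1) - klScale klE0 n)) * β / π + 1) * ((8 / klScale klE0 (n + 1)) / ((klScale klE0 n + t * (klScale klE0 (n + 1) - klScale klE0 n)) / 2) ^ 4)) +
                (2 * (klScale klE0 n + t * (klScale klE0 (n + 1) - klScale klE0 n))) ^ 3 *
                  (((klScale klE0 n + t * (klScale klE0 (n + 1) - klScale klE0 n)) * β / π + 1) * (((2 * (448 / 3 * Real.exp 2) + 72) / klScale klE0 (n + 1) ^ 3) / ((klScale klE0 n + t * (klScale klE0 (n + 1) - klScale klE0 n)) / 2) ^ 4 + 2 * (8 / klScale klE0 (n + 1)) / ((klScale klE0 n + t * (klScale klE0 (n + 1) - klScale klE0 n)) / 2) ^ 6)) *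
                  (2 * (2 * (klScale klE0 n + t * (klScale klE0 (n + 1) - klScale klE0 n)))))) *
            ((klScale klE0 n + t * (klScale klE0 (n + 1) - klScale klE0 n)) * (((L : ℝ) / (2 * π)) ^ 2 *
              (4 * π * (1 / (B.Dtmin - 2 * Af) ^ 2 + Real.pi * Real.sqrt 2 * (2 + 4 * Af) / (B.Dtmin - 2 * Af) ^ 3) *
                  (klScale klE0 n + t * (klScale klE0 (n + 1) - klScale klE0 n)) ^ 2 +
                4 * (2 * π * (π * Real.sqrt 2 / (B.Dtmin - 2 * Af))) * ((4 + 2 * Af) * (2 * π / L)))))) +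
          ((klScale klE0 n - klScale klE0 (n + 1)) * ‖∑ σ : Fin 2, T σ * Sg₀‖ *
            (((2 * π) ^ 2)⁻¹ * (2 * π * (π * Real.sqrt 2 / (B.Dtmin - 2 * Af)) *
                  ((2 * (klScale klE0 n + t * (klScale klE0 (n + 1) - klScale klE0 n)) * (2 * (klScale klE0 n + t * (klScale klE0 (n + 1) - klScale klE0 n)) *
                    (2 * (klScale klE0 n + t * (klScale klE0 (n + 1) - klScale klE0 n)) ^ 2 * (((2 * (448 / 3 * Real.exp 2) + 72) / klScale klE0 (n + 1) ^ 3) / ((klScale klE0 n + t * (klScale klE0 (n + 1) - klScale klE0 n)) / 2) ^ 4 + 2 * (8 / klScale klE0 (n + 1)) / ((klScale klE0 n + t * (klScale klE0 (n + 1) - klScale klE0 n)) / 2) ^ 6) + (((2 * (448 / 3 * Real.exp 2) + 72) / klScale klE0 (n + 1) ^ 3) / ((klScale klE0 n + t * (klScale klE0 (n + 1) - klScale klE0 n)) / 2) ^ 2 + (8 / klScale klE0 (n + 1)) / ((klScale klE0 n + t * (klScale klE0 (n + 1) - klScale klE0 n)) / 2) ^ 4)))) *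
                    ((klScale klE0 n + t * (klScale klE0 (n + 1) - klScale klE0 n)) + 2 * Real.pi / β) / β) +
                β⁻¹ * (((klScale klE0 n + t * (klScale klE0 (n + 1) - klScale klE0 n)) * β / π + 1) *
                  (2 * (klScale klE0 n + t * (klScale klE0 (n + 1) - klScale klE0 n)) *
                    (2 * π * (1 / (B.Dtmin - 2 * Af) ^ 2 + Real.pi * Real.sqrt 2 * (2 + 4 * Af) / (B.Dtmin - 2 * Af) ^ 3) *
                      (klScale klE0 n + t * (klScale klE0 (n + 1) - klScale klE0 n)) * ((8 / klScale klE0 (n + 1)) / ((klScale klE0 n + t * (klScale klE0 (n + 1) - klScale klE0 n)) / 2) ^ 2))))) +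
              ((klScale klE0 n + t * (klScale klE0 (n + 1) - klScale klE0 n)) / π + 3 / β) *
                (2 * π * (2 * (klScale klE0 n + t * (klScale klE0 (n + 1) - klScale klE0 n)) *
                  (2 * (klScale klE0 n + t * (klScale klE0 (n + 1) - klScale klE0 n)) ^ 2 * (((2 * (448 / 3 * Real.exp 2) + 72) / klScale klE0 (n + 1) ^ 3) / ((klScale klE0 n + t * (klScale klE0 (n + 1) - klScale klE0 n)) / 2) ^ 4 + 2 * (8 / klScale klE0 (n + 1)) / ((klScale klE0 n + t * (klScale klE0 (n + 1) - klScale klE0 n)) / 2) ^ 6) + (((2 * (448 / 3 * Real.exp 2) + 72) / klScale klE0 (n + 1) ^ 3) / ((klScale klE0 n + t * (klScale klE0 (n + 1) - klScale klE0 n)) / 2) ^ 2 + (8 / klScale klE0 (n + 1)) / ((klScale klE0 n + t * (klScale klE0 (n + 1) - klScale klE0 n)) / 2) ^ 4)) *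
                  (4 + 2 * Af)) / L)) +
            (2 : ℝ) ^ 10 * 15367 * δ) ≤
            (klScale klE0 n - klScale klE0 (n + 1)) * ((β * (L : ℝ) ^ 2) ^ 3)⁻¹ * RS x y) ∧
        (∀ t ∈ Icc (0 : ℝ) 1, ∀ x y : TorusSite 2 L, ‖∑ z : TorusSite 2 L × MatsubaraIdx M, Br (n + 1) Qm t z * ((if z.1 ∈ klBall L μ 0 then V (n + 1) t ![(((omega0 M, z.1), 0), 0), ((((omega0 M).rev, Qm - z.1), 1), 0), ((((omega0 M).rev, Qm - x), 1), 1), (((omega0 M, x), 0), 1)] * V (n + 1) t ![(((omega0 M, y), 0), 0), ((((omega0 M).rev, Qm - y), 1), 0), ((((omega0 M).rev, Qm - z.1), 1), 1), (((omega0 M, z.1), 0), 1)] else 0) - V (n + 1) t ![(((z.2, z.1), 0), 0), (((z.2.rev, Qm - z.1), 1), 0), ((((omega0 M).rev, Qm - x), 1), 1), (((omega0 M, x), 0), 1)] * V (n + 1) t ![(((omega0 M, y), 0), 0), ((((omega0 M).rev, Qm - y), 1), 0), (((z.2.rev, Qm - z.1), 1), 1), (((z.2, z.1), 0), 1)])‖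 ≤ RL x y) ∧
        -- consumer-side rows at the bar `Tb Qm` and the slot `Bar Qm`; the source majorant `FT_ρ[J] + FT_w[η]` WRITTEN OUT with `J = (Λd)(½RH + (βL²)⁻³(RP + RQ + 2RS)) + RL`
        (∀ x y, Tb Qm x y ≤ r') ∧
        (∀ x y, ((((klScale klE0 n - klScale klE0 (n + 1)) * (2⁻¹ * RH x y + ((β * (L : ℝ) ^ 2) ^ 3)⁻¹ * (RP x y + RQ x y + 2 * RS x y)) + RL x y) + 3 / 2 * (3 / 2 * m) * ∑ c, ((klScale klE0 n - klScale klE0 (n + 1)) * (2⁻¹ * RH x c + ((β * (L : ℝ) ^ 2) ^ 3)⁻¹ * (RP x c + RQ x c + 2 * RS x c)) + RL x c) * ρ (n + 1) Qm c + 3 / 2 * m * ∑ a, ρ (n + 1) Qm a * ((klScale klE0 n - klScale klE0 (n + 1)) * (2⁻¹ * RH a y + ((β * (L : ℝ) ^ 2) ^ 3)⁻¹ * (RP a y + RQ a y + 2 * RS a y)) + RL a y) + 9 / 4 * m * (3 / 2 * m) * ∑ a, ∑ c, ρ (n + 1) Qm a * ((klScale klE0 n - klScale klE0 (n + 1)) *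 (2⁻¹ * RH a c + ((β * (L : ℝ) ^ 2) ^ 3)⁻¹ * (RP a c + RQ a c + 2 * RS a c)) + RL a c) * ρ (n + 1) Qm c) +
            (η x y + 3 / 2 * (3 / 2 * m) * ∑ t, η x t * |klSliceWeightSmeared L M β μ (klFlowFrameU L M β U μ (n + 1)) (n + 1) (fun _ => (0 : ℝ)) Qm t| + 3 / 2 * (3 / 2 * m + r') * ∑ a, |klSliceWeightSmeared L M β μ (klFlowFrameU L M β U μ (n + 1)) (n + 1) (fun _ => (0 : ℝ)) Qm a| * η a y + 9 / 4 * (3 / 2 * m + r') * (3 / 2 * m) * ∑ a, ∑ t, |klSliceWeightSmeared L M β μ (klFlowFrameU L M β U μ (n + 1)) (n + 1) (fun _ => (0 : ℝ)) Qm a| * η a t * |klSliceWeightSmeared L M β μ (klFlowFrameU L M β U μ (n + 1)) (n + 1) (fun _ => (0 : ℝ)) Qm t|)) +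
          (Tb Qm x y + 3 / 2 * (3 / 2 * m) * ∑ t, Tb Qm x t * |klSliceWeightSmeared L M β μ (klFlowFrameU L M β U μ (n + 1)) (n + 1) (fun _ => (0 : ℝ)) Qm t| + 3 / 2 * (3 / 2 * m + r') * ∑ a, |klSliceWeightSmeared L M β μ (klFlowFrameU L M β U μ (n + 1)) (n + 1) (fun _ => (0 : ℝ)) Qm a| * Tb Qm a y + 9 / 4 * (3 / 2 * m + r') * (3 / 2 * m) * ∑ a, ∑ t, |klSliceWeightSmeared L M β μ (klFlowFrameU L M β U μ (n + 1)) (n + 1) (fun _ => (0 : ℝ)) Qm a| * Tb Qm a t * |klSliceWeightSmeared L M β μ (klFlowFrameU L M β U μ (n + 1)) (n + 1) (fun _ => (0 : ℝ)) Qm t|) ≤ E₁ x y) ∧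
        (∀ x y, E₁ x y ≤ e₁) ∧
        (∀ k ∈ klBall L μ 0, ∀ k' ∈ klBall L μ 0, E₁ k k' ≤ Bar Qm k k')) :
    ∀ Qm : TorusSite 2 L, IsPairClassAt L Qm (n + 1) →
      ∃ (X Nm : Matrix (TorusSite 2 L) (TorusSite 2 L) ℂ) (w₁ : TorusSite 2 L → ℝ) (Ea E₁ : TorusSite 2 L → TorusSite 2 L → ℝ) (r' e₁ : ℝ),
        0 ≤ r' ∧ 0 ≤ e₁ ∧
        (∀ x y, ¬(x ∈ klBall L μ 0 ∧ y ∈ klBall L μ 0) → X x y = 0) ∧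
        (∀ k ∈ klBall L μ 0, ∀ k' ∈ klBall L μ 0,
          X k k' = klCovSmearedPairAmplitude L M β U μ (klFlowFrameU L M β U μ n) n
            (softCovOf L M β μ (klFlowFrameU L M β U μ n) (softSymbolCompl L M β μ (klFlowFrameU L M β U μ n) n (n + 1))) Qm k k') ∧
        (∀ x y, 0 ≤ Ea x y) ∧
        (1 + Matrix.diagonal (fun p => (w₁ p : ℂ)) * X) * Nm = 1 ∧
        (∀ k ∈ klBall L μ 0, ∀ k' ∈ klBall L μ 0, ‖klPairArrayF L M β U μ (n + 1) Qm k k' - (X * Nm) k k'‖ ≤ Ea k k') ∧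
        (∀ x y, Tb Qm x y ≤ r') ∧
        (∀ x y, Ea x y + (Tb Qm x y + 3 / 2 * (3 / 2 * m) * ∑ t, Tb Qm x t * |w₁ t| + 3 / 2 * (3 / 2 * m + r') * ∑ a, |w₁ a| * Tb Qm a y +
            9 / 4 * (3 / 2 * m + r') * (3 / 2 * m) * ∑ a, ∑ t, |w₁ a| * Tb Qm a t * |w₁ t|) ≤ E₁ x y) ∧
        (∀ x y, E₁ x y ≤ e₁) ∧
        (3 / 2 * m + r') * ∑ a, |w₁ a| ≤ 1 / 3 ∧
        (∑ p, |w₁ p| ≤ 3 / 4 * G.bhi) ∧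
        (∑ p, (|w₁ p| - w₁ p) ≤ klEdge G (n + 1) (klTorusNorm L Qm)) ∧
        (∀ k ∈ klBall L μ 0, ∀ k' ∈ klBall L μ 0, E₁ k k' ≤ Bar Qm k k')  := by
  refine klmt_htower_family_values L M hm hm7 hK hβ hβL hG hZ A A' b b' ρ V V6 Sg Hd Φ Wd Br hAdef hA'def hbdef hb'def hρdef hV hV6 hSg hHd hΦ hWd hBr Tb Bar ?_
  intro Qm hQm
  obtain ⟨r', e₁, η, E₁, RH, RP, RQ, RS, RL, hr', he₁, hAm, hXm, hη, hηe, hsm₁, hRH, hRP, hRQ, hSD, hRL, hTb, hE₁, hE₁e, hbar⟩ := hrows Qm hQm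
  clear hrows
  refine ⟨r', e₁, η, E₁, RH, RP, RQ, RS, RL, hr', he₁, hAm, hXm, hη, hηe, hsm₁, hRH, hRP, hRQ, ?_, hRL, hTb, hE₁, hE₁e, hbar⟩
  intro t ht x y
  obtain ⟨T, Sg₀, zω, ze, δ, hδ0, hδ, hdom⟩ := hSD t ht x y
  obtain ⟨hr₁, hbd, hlip, hin, hout⟩ := klmt_sliceProfile (scaleAt_mem n ht).1 (scaleAt_mem n ht).2
  have h5 := klok_localisedBorn_row_full_le (L := L) (M := M) hK hβ hβL B hAf hADt hlo hhi n ht Φ hΦ Wd hWd (le_refl (n + 1)) (hΛr t ht) (hMt t ht)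
    hr₁ hbd hlip hin hout (fun p σ => V6 (n + 1) t ![((p, σ), 0), ((p, σ), 1), (((omega0 M, y), 0), 0), ((((omega0 M).rev, Qm - y), 1), 0), ((((omega0 M).rev, Qm - x), 1), 1), (((omega0 M, x), 0), 1)] * Sg (n + 1) t p σ) T Sg₀ zω ze hδ0 hδ
  have hβ0 : 0 < β := pos_of_klBetaMin_le hβ
  have hL : (0 : ℝ) < L := hβ0.trans_le hβL
  have hpos : 0 < (klScale klE0 n - klScale klE0 (n + 1)) * ((β * (L : ℝ) ^ 2) ^ 3)⁻¹ := by
    have h4 : klScale klE0 (n + 1) = klScale klE0 n / 4 := klth_klScale_succ n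
    have h1 : 0 < klScale klE0 n := klth_klScale_pos n
    have : 0 < klScale klE0 n - klScale klE0 (n + 1) := by rw [h4]; linarith
    positivity
  exact le_of_mul_le_mul_left (h5.trans hdom) hpos

end Summit.HubbardSuperconductivity.HubbardSuperconductivity.Theorems.KLRegimeSplit

end
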